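import Mathlib
import HarnessLib

/-!
# Thermal wedge, crux `TwSourcedInertness`: the dyadic ladder (pure real analysis)

Route `ThermalWedge` of `HubbardSuperconductivity`, item stmt-HubbardSuperconductivity-1696
(`Summit.HubbardSuperconductivity.HubbardSuperconductivity.Theses.ThermalWedge.TwSourcedInertness`).
This file contains NO physics: it is the real-analysis bookkeeping (`tw_staircase`) by which a
pressure-like family `P L β h`, antitone in `β` and Lipschitz in `h`, inherits the all-`h` bound
`P L β h - P L β 0 ≤ C (1 + log β) h²` from (LIN) the same bound on the thermal disc `|h| β ≤ c` and
(TH) the dyadic thermal increment `P L (β/2) 0 - P L β 0 ≤ C₂ (1 + log β)/β²`, with `L₀` a finite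
maximum over the dyadic ladder `β/2^j`, `j ≤ ⌈β⌉₊` (so the quantifier order `∃ L₀` after `β`, before
`h`, of the crux is respected). The matrix facts and the reduction of the crux itself are in
`ThermalWedgeTwSourcedInertnessStaircase.lean`.

Mechanism: for `c/β < |h| < c/2` climb at fixed `h` to the hotter `β' = β/2^k ∈ (c/(2|h|), c/|h|]`
(free, by antitonicity), cross there inside the thermal disc (`log β' ≤ log β`), and descend at `h = 0`
along the ladder paying `Σ_{j<k} C₂(1+log β) 4^j/β² ≤ C₂(1+log β)/β'² ≤ (4C₂/c²)(1+log β) h²`;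
for `|h| ≥ c/2` the Lipschitz bound `A|h| ≤ (2A/c) h²` suffices. Standard axioms only.
-/

namespace Summit.HubbardSuperconductivity.HubbardSuperconductivity.Theorems

noncomputable section

/-! ### The dyadic staircase (pure real analysis) -/

/-- Large-source algebra: `c/2 ≤ |h|` turns the Lipschitz bound `A|h|` into `(2A/c)(1+l)h²`. -/
theorem tw_aux_large {c A l h : ℝ} (hc : 0 < c) (hA : 0 ≤ A) (hl : 0 ≤ l) (hh : c / 2 ≤ |h|) :
    A * |h| ≤ 2 * A / c * (1 + l) * h ^ 2 := by
  have h1 : c ≤ 2 * |h| := by linarith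
  have h2 : A * |h| * c ≤ 2 * A * h ^ 2 :=
    calc A * |h| * c ≤ A * |h| * (2 * |h|) :=
          mul_le_mul_of_nonneg_left h1 (mul_nonneg hA (abs_nonneg h))
      _ = 2 * A * |h| ^ 2 := by ring
      _ = 2 * A * h ^ 2 := by rw [sq_abs]
  have h3 : A * |h| ≤ 2 * A / c * h ^ 2 := by
    rw [div_mul_eq_mul_div, le_div_iff₀ hc]
    exact h2
  have h4 : 0 ≤ 2 * A / c * h ^ 2 * l := by positivity
  calc A * |h| ≤ 2 * A / c * h ^ 2 := h3
    _ ≤ 2 * A / c * h ^ 2 + 2 * A / c * h ^ 2 * l := le_add_of_nonneg_right h4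
    _ = 2 * A / c * (1 + l) * h ^ 2 := by ring

/-- One rung of the ladder: at `x = β/2^j`, `C₂(1 + log x)/x² ≤ C₂(1 + log β)·4^j/β²`. -/
theorem tw_aux_rung {C₂ x β : ℝ} {j : ℕ} (hC₂ : 0 ≤ C₂) (hβ : 0 < β) (hx : x = β / 2 ^ j) :
    C₂ * (1 + Real.log x) / x ^ 2 ≤ C₂ * (1 + Real.log β) / β ^ 2 * 4 ^ j := by
  have hxpos : 0 < x := by
    rw [hx]
    positivity
  have hxβ : x ≤ β := by
    rw [hx]
    exact div_le_self hβ.le (one_le_pow₀ (by norm_num))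
  have hlog : Real.log x ≤ Real.log β := Real.log_le_log hxpos hxβ
  have hnum : C₂ * (1 + Real.log x) ≤ C₂ * (1 + Real.log β) :=
    mul_le_mul_of_nonneg_left (by linarith) hC₂
  have h4 : ((2 : ℝ) ^ j) ^ 2 = 4 ^ j := by
    rw [← pow_mul, mul_comm, pow_mul]
    norm_num
  have hx2 : x ^ 2 = β ^ 2 / 4 ^ j := by
    rw [hx, div_pow, h4]
  calc C₂ * (1 + Real.log x) / x ^ 2 ≤ C₂ * (1 + Real.log β) / x ^ 2 :=
        div_le_div_of_nonneg_right hnum (by positivity)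
    _ = C₂ * (1 + Real.log β) / β ^ 2 * 4 ^ j := by
        rw [hx2]
        field_simp

/-- The whole ladder: if `β = β'·2^k` and the rung below `β'` is outside the thermal disc
(`c < 2β'|h|`), then `D/β² · Σ_{j<k} 4^j ≤ D/β'² ≤ (4D/c²) h²`. -/
theorem tw_aux_ladder {c D β β' h : ℝ} {k : ℕ} (hc : 0 < c) (hD : 0 ≤ D) (hβ' : 0 < β')
    (hk : β = β' * 2 ^ k) (h1 : c < |h| * (2 * β')) :
    D / β ^ 2 * ∑ j ∈ Finset.range k, (4 : ℝ) ^ j ≤ 4 * D / c ^ 2 * h ^ 2 := by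
  have hgeom : ∑ j ∈ Finset.range k, (4 : ℝ) ^ j ≤ 4 ^ k := by
    have h4 : ∑ j ∈ Finset.range k, (4 : ℝ) ^ j = ((4 : ℝ) ^ k - 1) / (4 - 1) :=
      geom_sum_eq (by norm_num) k
    have h0 : (0 : ℝ) ≤ 4 ^ k := by positivity
    rw [h4, div_le_iff₀ (by norm_num : (0 : ℝ) < 4 - 1)]
    linarith
  have h4k : ((2 : ℝ) ^ k) ^ 2 = 4 ^ k := by
    rw [← pow_mul, mul_comm, pow_mul]
    norm_num
  have hβpos : 0 < β := by
    rw [hk]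
    positivity
  calc D / β ^ 2 * ∑ j ∈ Finset.range k, (4 : ℝ) ^ j ≤ D / β ^ 2 * 4 ^ k :=
        mul_le_mul_of_nonneg_left hgeom (by positivity)
    _ = D / β' ^ 2 := by
        rw [← h4k, hk]
        field_simp
    _ ≤ D * (4 * h ^ 2 / c ^ 2) := by
        rw [div_eq_mul_inv]
        refine mul_le_mul_of_nonneg_left ?_ hD
        rw [inv_eq_one_div, div_le_div_iff₀ (by positivity) (by positivity)]
        have h3 : c ^ 2 ≤ (|h| * (2 * β')) ^ 2 := pow_le_pow_left₀ hc.le h1.le 2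
        calc 1 * c ^ 2 = c ^ 2 := one_mul _
          _ ≤ (|h| * (2 * β')) ^ 2 := h3
          _ = 4 * h ^ 2 * β' ^ 2 := by
              rw [mul_pow, mul_pow, sq_abs]
              ring
    _ = 4 * D / c ^ 2 * h ^ 2 := by ring

/-- The minimal rung of the dyadic ladder `β/2^j` inside the thermal disc `|h|·β/2^k ≤ c`
(for `|h| < c/2`, `β ≥ 1`): it exists below `⌈β⌉₊`, sits at a temperature `≤ 1` (`β/2^k ≥ 1`),
every rung above it is at `β/2^j ≥ 2`, and (if `k ≥ 1`) the rung just above is outside the disc. -/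
theorem tw_aux_minimal_rung {β c h : ℝ} (hc : 0 < c) (hβ : 1 ≤ β) (hh : |h| < c / 2) :
    ∃ k : ℕ, k ≤ ⌈β⌉₊ ∧ |h| * (β / 2 ^ k) ≤ c ∧ 1 ≤ β / 2 ^ k ∧
      (∀ j, j < k → 2 ≤ β / 2 ^ j) ∧ (0 < k → c < |h| * (2 * (β / 2 ^ k))) := by
  classical
  have hβpos : 0 < β := by linarith
  have hhc : |h| ≤ c := by linarith
  have h2K : β < (2 : ℝ) ^ ⌈β⌉₊ := by
    have h1 : β ≤ (⌈β⌉₊ : ℝ) := Nat.le_ceil β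
    have h2 : ((⌈β⌉₊ : ℕ) : ℝ) < (2 : ℝ) ^ ⌈β⌉₊ := by exact_mod_cast Nat.lt_two_pow_self
    linarith
  have hK1 : β / 2 ^ ⌈β⌉₊ ≤ 1 := by
    rw [div_le_one (by positivity)]
    exact h2K.le
  have hKwit : |h| * (β / 2 ^ ⌈β⌉₊) ≤ c :=
    calc |h| * (β / 2 ^ ⌈β⌉₊) ≤ c * 1 := mul_le_mul hhc hK1 (by positivity) hc.le
      _ = c := mul_one c
  have hex : ∃ k : ℕ, |h| * (β / 2 ^ k) ≤ c := ⟨⌈β⌉₊, hKwit⟩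
  obtain ⟨k, hkK, hkspec, hkmin⟩ : ∃ k : ℕ, k ≤ ⌈β⌉₊ ∧ |h| * (β / 2 ^ k) ≤ c ∧
      ∀ j, j < k → c < |h| * (β / 2 ^ j) :=
    ⟨Nat.find hex, Nat.find_min' hex hKwit, Nat.find_spec hex,
      fun j hj => not_le.mp (Nat.find_min hex hj)⟩
  have hout : ∀ j, j < k → 2 ≤ β / 2 ^ j := by
    intro j hj
    have hmin := hkmin j hj
    by_contra hlt
    have hlt' : β / 2 ^ j < 2 := not_le.mp hlt
    have hpos : 0 ≤ β / 2 ^ j := by positivity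
    have h1 : |h| * (β / 2 ^ j) ≤ c / 2 * 2 := mul_le_mul hh.le hlt'.le hpos (by linarith)
    linarith
  have hprev : 0 < k → c < |h| * (2 * (β / 2 ^ k)) := by
    intro hkpos
    have h1 := hkmin (k - 1) (by omega)
    have h2 : β / 2 ^ (k - 1) = 2 * (β / 2 ^ k) := by
      have h3 : (2 : ℝ) ^ k = 2 ^ (k - 1) * 2 := by
        rw [← pow_succ]
        congr 1
        omega
      rw [h3]
      field_simp
    rwa [h2] at h1
  have hone : 1 ≤ β / 2 ^ k := by
    rcases Nat.eq_zero_or_pos k with hk0 | hkpos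
    · rw [hk0, pow_zero, div_one]
      exact hβ
    · have h1 := hprev hkpos
      by_contra hlt
      have hlt' : β / 2 ^ k < 1 := not_le.mp hlt
      have h2 : 2 * (β / 2 ^ k) ≤ 2 := by linarith
      have h3 : |h| * (2 * (β / 2 ^ k)) ≤ c / 2 * 2 := mul_le_mul hh.le h2 (by positivity) (by linarith)
      linarith
  exact ⟨k, hkK, hkspec, hone, hout, hprev⟩

/-- **Dyadic staircase.** Let `P L β h` be real numbers (`L ≥ 1`, think `p̃_L(β,h)`), antitone in
`β > 0` at fixed `h`, with `P L β h - P L β 0 ≤ A|h|` (`β ≥ 1`). Assume, for `β` in `[1,B]`,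
eventually in `L`: the small-source bound `P L β h - P L β 0 ≤ C₁(1+log β)h²` on the thermal disc
`|h| β ≤ c`, and for `β ∈ [2,B]` the dyadic thermal increment `P L (β/2) 0 - P L β 0 ≤ C₂(1+log β)/β²`.
Then for every `β ∈ [1,B]`, eventually in `L`, for ALL real `h`:
`P L β h - P L β 0 ≤ (C₁ + 4C₂/c² + 2A/c)(1 + log β) h²`. -/
theorem tw_staircase {P : (L : ℕ) → [NeZero L] → ℝ → ℝ → ℝ} {B c C₁ C₂ A : ℝ}
    (hc : 0 < c) (hC₁ : 0 ≤ C₁) (hC₂ : 0 ≤ C₂) (hA : 0 ≤ A)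
    (anti : ∀ (L : ℕ) [NeZero L] (β β' h : ℝ), 0 < β' → β' ≤ β → P L β h ≤ P L β' h)
    (lip : ∀ (L : ℕ) [NeZero L] (β h : ℝ), 1 ≤ β → P L β h - P L β 0 ≤ A * |h|)
    (lin : ∀ β : ℝ, 1 ≤ β → β ≤ B → ∃ L₀ : ℕ, ∀ (L : ℕ) [NeZero L], L₀ ≤ L → ∀ h : ℝ,
      |h| * β ≤ c → P L β h - P L β 0 ≤ C₁ * (1 + Real.log β) * h ^ 2)
    (th : ∀ β : ℝ, 2 ≤ β → β ≤ B → ∃ L₀ : ℕ, ∀ (L : ℕ) [NeZero L], L₀ ≤ L →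
      P L (β / 2) 0 - P L β 0 ≤ C₂ * (1 + Real.log β) / β ^ 2)
    {β : ℝ} (hβ : 1 ≤ β) (hβB : β ≤ B) :
    ∃ L₀ : ℕ, ∀ (L : ℕ) [NeZero L], L₀ ≤ L → ∀ h : ℝ,
      P L β h - P L β 0 ≤ (C₁ + 4 * C₂ / c ^ 2 + 2 * A / c) * (1 + Real.log β) * h ^ 2 := by
  classical
  -- total versions of the two `eventually in L` hypotheses, then choice functions
  have lin' : ∀ β' : ℝ, ∃ L₀ : ℕ, 1 ≤ β' → β' ≤ B → ∀ (L : ℕ) [NeZero L], L₀ ≤ L → ∀ h : ℝ,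
      |h| * β' ≤ c → P L β' h - P L β' 0 ≤ C₁ * (1 + Real.log β') * h ^ 2 := by
    intro β'
    by_cases hb : 1 ≤ β' ∧ β' ≤ B
    · obtain ⟨L₀, hL₀⟩ := lin β' hb.1 hb.2
      exact ⟨L₀, fun _ _ => hL₀⟩
    · exact ⟨0, fun h1 h2 => (hb ⟨h1, h2⟩).elim⟩
  have th' : ∀ β' : ℝ, ∃ L₀ : ℕ, 2 ≤ β' → β' ≤ B → ∀ (L : ℕ) [NeZero L], L₀ ≤ L →
      P L (β' / 2) 0 - P L β' 0 ≤ C₂ * (1 + Real.log β') / β' ^ 2 := by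
    intro β'
    by_cases hb : 2 ≤ β' ∧ β' ≤ B
    · obtain ⟨L₀, hL₀⟩ := th β' hb.1 hb.2
      exact ⟨L₀, fun _ _ => hL₀⟩
    · exact ⟨0, fun h1 h2 => (hb ⟨h1, h2⟩).elim⟩
  choose fL hfL using lin'
  choose fT hfT using th'
  have hβpos : 0 < β := one_pos.trans_le hβ
  have hlogβ : 0 ≤ Real.log β := Real.log_nonneg hβ
  -- L₀: the largest threshold over the dyadic ladder β / 2^j, j ≤ ⌈β⌉₊
  refine ⟨(Finset.range (⌈β⌉₊ + 1)).sup fun j => max (fL (β / 2 ^ j)) (fT (β / 2 ^ j)), ?_⟩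
  intro L _ hL h
  have hLj : ∀ j, j ≤ ⌈β⌉₊ → fL (β / 2 ^ j) ≤ L ∧ fT (β / 2 ^ j) ≤ L := by
    intro j hj
    have hmem : j ∈ Finset.range (⌈β⌉₊ + 1) := Finset.mem_range.mpr (Nat.lt_succ_of_le hj)
    have hsup := (Finset.le_sup (f := fun j => max (fL (β / 2 ^ j)) (fT (β / 2 ^ j))) hmem).trans hL
    exact ⟨(le_max_left _ _).trans hsup, (le_max_right _ _).trans hsup⟩
  have hsq : 0 ≤ h ^ 2 := sq_nonneg h
  have hpiece1 : 0 ≤ C₁ * (1 + Real.log β) * h ^ 2 := by positivity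
  have hpiece2 : 0 ≤ 4 * C₂ / c ^ 2 * (1 + Real.log β) * h ^ 2 := by positivity
  have hpiece3 : 0 ≤ 2 * A / c * (1 + Real.log β) * h ^ 2 := by positivity
  have hsplit : (C₁ + 4 * C₂ / c ^ 2 + 2 * A / c) * (1 + Real.log β) * h ^ 2 =
      C₁ * (1 + Real.log β) * h ^ 2 + 4 * C₂ / c ^ 2 * (1 + Real.log β) * h ^ 2 +
        2 * A / c * (1 + Real.log β) * h ^ 2 := by ring
  rcases le_or_gt (c / 2) |h| with hlarge | hsmall
  · -- large source: Lipschitz regime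
    have h1 := lip L β h hβ
    have h2 := tw_aux_large hc hA hlogβ hlarge
    rw [hsplit]
    linarith only [h1, h2, hpiece1, hpiece2]
  · -- small source: climb the dyadic ladder to the thermal disc
    obtain ⟨k, hkK, hkspec, hone, hout, hprev⟩ := tw_aux_minimal_rung hc hβ hsmall
    obtain ⟨β', hβ'⟩ : ∃ β' : ℝ, β' = β / 2 ^ k := ⟨_, rfl⟩
    have hβ'pos : 0 < β' := by
      rw [hβ']
      positivity
    have hβ'le : β' ≤ β := by
      rw [hβ']
      exact div_le_self hβpos.le (one_le_pow₀ (by norm_num))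
    have hβ'one : 1 ≤ β' := by
      rw [hβ']
      exact hone
    -- (i) cross at β' inside the thermal disc
    have hcross : P L β' h - P L β' 0 ≤ C₁ * (1 + Real.log β) * h ^ 2 := by
      have hLk : fL β' ≤ L := by
        rw [hβ']
        exact (hLj k hkK).1
      have hdisc : |h| * β' ≤ c := by
        rw [hβ']
        exact hkspec
      have h1 := hfL β' hβ'one (hβ'le.trans hβB) L hLk h hdisc
      have h2 : Real.log β' ≤ Real.log β := Real.log_le_log hβ'pos hβ'le
      have h3 : C₁ * (1 + Real.log β') * h ^ 2 ≤ C₁ * (1 + Real.log β) * h ^ 2 :=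
        mul_le_mul_of_nonneg_right (mul_le_mul_of_nonneg_left (by linarith) hC₁) hsq
      linarith only [h1, h3]
    -- (ii) descend at h = 0 along the dyadic ladder
    have hstep : ∀ j ∈ Finset.range k,
        P L (β / 2 ^ (j + 1)) 0 - P L (β / 2 ^ j) 0 ≤ C₂ * (1 + Real.log β) / β ^ 2 * 4 ^ j := by
      intro j hj
      have hj' : j < k := Finset.mem_range.mp hj
      have hjK : j ≤ ⌈β⌉₊ := (Nat.le_of_lt hj').trans hkK
      have hβjle : β / 2 ^ j ≤ β := div_le_self hβpos.le (one_le_pow₀ (by norm_num))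
      have h1 := hfT (β / 2 ^ j) (hout j hj') (hβjle.trans hβB) L (hLj j hjK).2
      have hhalf : β / 2 ^ j / 2 = β / 2 ^ (j + 1) := by
        rw [pow_succ, div_div]
      rw [hhalf] at h1
      exact h1.trans (tw_aux_rung hC₂ hβpos rfl)
    have hdesc : P L β' 0 - P L β 0 ≤ 4 * C₂ / c ^ 2 * (1 + Real.log β) * h ^ 2 := by
      have htele := Finset.sum_range_sub (fun j => P L (β / 2 ^ j) 0) k
      simp only [pow_zero, div_one] at htele
      rw [← hβ'] at htele
      rw [← htele]
      refine (Finset.sum_le_sum hstep).trans ?_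
      rw [← Finset.mul_sum]
      rcases Nat.eq_zero_or_pos k with hk0 | hkpos
      · -- empty ladder
        rw [hk0, Finset.range_zero, Finset.sum_empty, mul_zero]
        exact hpiece2
      · have hββ' : β = β' * 2 ^ k := by
          rw [hβ']
          field_simp
        have h1 : c < |h| * (2 * β') := by
          rw [hβ']
          exact hprev hkpos
        have hcoef : 0 ≤ C₂ * (1 + Real.log β) := by positivity
        calc C₂ * (1 + Real.log β) / β ^ 2 * ∑ j ∈ Finset.range k, (4 : ℝ) ^ j
            ≤ 4 * (C₂ * (1 + Real.log β)) / c ^ 2 * h ^ 2 := tw_aux_ladder hc hcoef hβ'pos hββ' h1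
          _ = 4 * C₂ / c ^ 2 * (1 + Real.log β) * h ^ 2 := by ring
    -- (iii) climb at fixed h for free
    have hclimb : P L β h ≤ P L β' h := anti L β β' h hβ'pos hβ'le
    rw [hsplit]
    linarith only [hcross, hdesc, hclimb, hpiece3]

end

end Summit.HubbardSuperconductivity.HubbardSuperconductivity.Theorems
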